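/-
Copyright (c) 2026 the pub-hodgecm-mathlib formalisation cell (harness21).  Prover seat hodgecm-mathlib-K2E2-p12 (g0), Track B «K2-LIT»,
engine E2 «ThetaExhaustionByRigidity», unit CAPTURE, 2026-09-03.  KERNEL module: THEOREMS ONLY (no definition, no named fact, no `sorry`,
no instance, no notation).
-/
import Summits.HodgeConjecture.HodgeConjecture.Theorems.F0P2sNodeBPrimeHolds               -- ★ B′ `hasFinComponent_rhoAtLine_three_of_starProjection_ne_zero_of_coe`
import Summits.HodgeConjecture.HodgeConjecture.Theorems.F0P2dSocketD                       -- ★ SP `holCotFormSpectralProjection_holds`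
import Summits.HodgeConjecture.HodgeConjecture.Theorems.F0P3HolProjectionReduction         -- ★ `compactSpace_automorphicQuotient_cm`
import Literature.NumberTheory.Automorphic.Liu2021.ThetaLiftFromLineCharacters              -- ★ `eq_cmAdelicFrameTransport_of_coe`, `memLp_toQuotFun_lineThetaLift`
import HarnessLib

-- As in the lineage (★ `ThetaLiftFromLineCharacters`, the K2E2 Capture module): statements over the theta-kernel datum elaborate to very large
-- types; elaborate sequentially.
set_option Elab.async false

/-!
# K2 ∕ E2 «ThetaExhaustionByRigidity», unit CAPTURE — the repaired E2 letter `sig_K2E2CapHolThetaWitnessR` REDUCED TO ITS ARCHIMEDEAN ROW: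
# «a HOLOMORPHIC non-zero theta pair at the frame» ⟹ the pinned holomorphic theta witness (clauses (i), (ii-hol), (ii-fin))

Cell hodgecm-mathlib (D-0151), FLOOR 0, Track B «K2-LIT» (21-frontier RULING «PUSH BOTH», REQUESTS l.72341), engine E2, crux item H413 =
stmt-HodgeConjecture-24833 (route `HCCMUnconditional`, no route verbs); tier-1 socket module `Cruxes/H413/Lines/K2_E2_ThetaExhaustionByRigidity_Capture.lean`
(ddd3448accbba0ec).  Author K2E2-p12 (g0).  `--supports stmt-HodgeConjecture-24833 --as helper`; THEOREMS ONLY.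

WHY THIS FILE.  Socket #12 `sig_K2E2CapHolThetaWitness` is FALSE AS TYPED (memo `K2/K2E2-p12/g0/MISSTATED-sig_K2E2CapHolThetaWitness.K2E2-p12-g0.md`:
at a frame whose embedding `ι` lies OUTSIDE the CM type `Φ_μ` every theta class from the line `⟨a⟩` at the `μ`-splitting has ANTIholomorphic receivers,
[Liu2021, App. D Lem. D.2 (2)]); the repaired socket `sig_K2E2CapHolThetaWitnessR` (cand bytes c843a707efd7490a) adds `ι ∈ hμ.cmType.1`.  Its content splits
into (α) a purely ARCHIMEDEAN row — a pair `φ = (φ₀, φ₁)` of archimedean Schwartz vectors whose theta pair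
`(x, j) ↦ Θ̃_{R_{e₁}(φ_j ⊗ Φ_f)}(charCM χ̃_χ)(ι_A x)` is a HOLOMORPHIC cotangent form at `(cmArchSection L ι H T hT, cmCompactFactor …)` and is non-zero
(the `K_∞`-type ∕ compact-factor ∕ Cauchy–Riemann rows (W)(K)(H) of ★ B⁗ `F0P2sThetaPairsCotForms.thetaPair_mem_holCotForms_of_arch` plus the arch-fixed
row (E) of ★ (N5) `F0P2tThetaPairNeZeroOfFrame.thetaPair_ne_zero_of_archFixed_frame`; [KonnoKonno2007, Thm. 5.4] ∕ [Liu2021, App. D Lem. D.2, §D.1 Step 3]: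
the harmonic Gaussian of the admissible line, which exists exactly when `ι ∈ Φ_μ`) — and (β) the `L²` ∕ spectral ∕ finite-component packaging at the PINNED
transports `ιA`, `ιV`.  THIS FILE (§1) proves (β) once and for all, sorry-free, over ★ rows only:

* §1 **`capHolThetaWitness_of_holThetaPair`** — frame of the socket VERBATIM (`L ι H T hT hpos h2 e₁ dV hdV hdV0 g hg ιA hιA ιV hιV`, `[U(diag dV)]`
  compact, automorphic `μA`, `μ` conjugate-symplectic, `a`, `χ`); for ANY Weil majorants `hρ`, ANY finite invariant Borel `μ_W` on `[U(⟨a⟩)]`, ANY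
  `φ : Fin 2 → 𝓢`, `Φ_f`, `j₀`: IF the theta pair (read along the canonical transport ★ `cmAdelicFrameTransport L 3 H dV g hg` = `ιA` by ★
  `eq_cmAdelicFrameTransport_of_coe`) lies in `holCotForms … (cmArchSection L ι H T hT) (cmCompactFactor L ι H T hT)` and its `j₀`-th coordinate does
  not vanish identically, THEN the `∃`-clause of `sig_K2E2CapHolThetaWitness(R)` holds with the witnesses
  `(hρ, μ_W, f := charCM χ̃_χ, Φ := R_{e₁}(φ_{j₀} ⊗ Φ_f))`: (i) the class is non-zero (continuity ★ `continuous_toQuotFun_lineThetaLift` + `μA` charges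
  open sets, Mathlib `Continuous.ae_eq_iff_eq`); (ii-hol) every discrete `P′` with `pr_{P′}[…] ≠ 0` is `IsHolCotangentAt` (★ SP
  `F0P2dSocketD.holCotFormSpectralProjection_holds`: the projected pair is again a holomorphic cotangent form, non-zero, with classes in `P′`);
  (ii-fin) `P′.HasFinComponent ω_H(μ,a,χ)[ιV]` (★ B′ `hasFinComponent_rhoAtLine_three_of_starProjection_ne_zero_of_coe` at the pinned `ιV`).
  NO weight-one, admissibility or orientation hypothesis is needed for (β): they are consumed by (α) only.
* (sequel file `Theorems/K2E2CapHolThetaWitnessOfArchRows`, same seat) **`capHolThetaWitness_of_archRows`** — the same with (α) spelled as the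
  four archimedean rows (W)(K)(H) + (E) in the exact currency of ★ B⁗ ∕ ★ (N5); ★ (N5) supplies `Φ_f` with the pair non-zero, ★ B⁗ its holomorphy,
  §1 concludes.
So `sig_K2E2CapHolThetaWitnessR` ⟸ «(W)(K)(H)(E) for ONE archimedean pair at the frame» — the honest residual of the E2 letter, archimedean and local
(the same residual the desk's PLAN-P2 v13 named for Θ-OCC-GEN before ROAD A moved to the P4 engine's model currency, whose output is the ABSTRACT
`∃ θ` of ★ `exists_holTheta_atFrame_of_chiN`, not a literal `lineThetaKernelDatum` lift).
HONEST LABEL: HC_CM is proved only modulo the 7 printed citations (2 remaining named inputs: hLiu418 = stmt-HodgeConjecture-24832, h413 =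
stmt-HodgeConjecture-24833) until rung 0 closes; this file discharges no printed citation — it is kernel glue over ★ rows.

## References
* [Liu2021] Y. Liu, *Fourier–Jacobi cycles and arithmetic relative trace formula*, Camb. J. Math. 9 (2021) = arXiv:2102.11518: proof of Prop. 4.13 Case 1
  (l. 2131–2141, p. 48) and «Conversely» (l. 2145–2149); Def. 4.11–4.12; App. D §D.1 Step 3, Lem. D.1, Lem. D.2 (2).
* [KonnoKonno2007] T. Konno, K. Konno, Kyushu J. Math. 61 (2007), Thm. 5.4 p. 75.  [GelbartRogawski1991] Invent. Math. 105 (1991), §3.2 p. 457, Prop. 3.1.1.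
* [BorelJacquet1979] A. Borel, H. Jacquet, PSPM 33.1 (1979), §4.1, §4.2, §4.6.  [Borel1997] A. Borel, *Automorphic forms on SL₂(ℝ)*, Thm. 2.13, §5.14, §8.4.
* [Rallis1984] S. Rallis, Compositio Math. 51 (1984), Thm. 1.2.2.  [GetzHahn2024] J. Getz, H. Hahn, GTM 300, Thm. 2.6.2, Thm. 3.2.2.
-/

set_option autoImplicit false
-- the mandated namespace has the single-problem summit's repeated segment (`HodgeConjecture.HodgeConjecture`)
set_option linter.dupNamespace false

noncomputable section

namespace Summit.HodgeConjecture.HodgeConjecture.Cruxes.H413.K2E2CapHolThetaWitness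

open scoped TensorProduct Matrix Kronecker ComplexOrder ENNReal SchwartzMap Classical
open NumberField NumberField.InfinitePlace IsDedekindDomain MeasureTheory MulAction
open Literature.NumberTheory Literature.NumberTheory.Automorphic Literature.NumberTheory.Automorphic.UnitaryGroup
open Literature.NumberTheory.Automorphic.UnitaryGroup.CotangentForms
open Literature.NumberTheory.Automorphic.Liu2021
open Literature.NumberTheory.Automorphic.Liu2021.Def411WeilCarriers
open Literature.NumberTheory.Automorphic.Liu2021.Def411WeilCarriersDoubling
open Literature.NumberTheory.Automorphic.IdeleClassGroup
open Literature.NumberTheory.GelbartRogawski1991 Literature.NumberTheory.GelbartRogawski1991.UnitaryDualPair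
open Literature.NumberTheory.GelbartRogawski1991.UnitaryDualPair.WeilCoinv
open Literature.NumberTheory.Weil1964
open Literature.RepresentationTheory Literature.RepresentationTheory.Liu2021
open Literature.RepresentationTheory.CompactGroups
open Literature.AlgebraicGeometry.ShimuraVarieties (BallForms.isPullbackCocycle_cotangentCocycle)
open Literature.Geometry.ComplexHyperbolic.BallModel (U21 x₀)
open Summit.HodgeConjecture.CorCM
open Summit.HodgeConjecture.CorCM.Transposition
open Summit.HodgeConjecture.HodgeConjecture.Cruxes.H413
open Summit.HodgeConjecture.HodgeConjecture.Cruxes.H413.F0P2dSocketD (holCotFormSpectralProjection_holds)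
open Summit.HodgeConjecture.HodgeConjecture.Cruxes.H413.F0P3HolProjectionReduction (compactSpace_automorphicQuotient_cm four_le_finrank_of_two_le)

/-! ## §1 The packaging: a holomorphic, non-zero theta pair gives the pinned holomorphic theta witness -/

set_option synthInstance.maxHeartbeats 400000 in
set_option maxHeartbeats 16000000 in
/-- **`sig_K2E2CapHolThetaWitness(R)` ⟸ a HOLOMORPHIC NON-ZERO THETA PAIR at the frame.**  Frame of the socket verbatim; `hρ`, `μ_W` (finite, invariant,
Borel), `φ : Fin 2 → 𝓢`, `Φ_f`, `j₀` arbitrary.  If the theta pair `(x, j) ↦ Θ̃_{R_{e₁}(φ_j ⊗ Φ_f)}(charCM χ̃_χ)(g_𝔸⁻¹ x g_𝔸)` lies in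
`holCotForms … (cmArchSection L ι H T hT) (cmCompactFactor L ι H T hT)` and its `j₀`-th coordinate is not identically zero, then the class
`[x ↦ Θ̃_{R_{e₁}(φ_{j₀} ⊗ Φ_f)}(charCM χ̃_χ)(ιA x)] ∈ L²([U(H)], μA)` is NON-ZERO, and every discrete `P′` on which it projects non-trivially is
holomorphic-cotangent at `(ι, T)` with finite component `ω_H(μ, a, χ)[ιV]` — the `∃`-clause of the socket with witnesses `(hρ, μ_W, charCM χ̃_χ, R_{e₁}(φ_{j₀} ⊗ Φ_f))`.
Steps, all ★: `ιA` IS the canonical transport (`eq_cmAdelicFrameTransport_of_coe`); `L²`-membership and continuity of the descended lift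
(`memLp_toQuotFun_lineThetaLift`, `continuous_toQuotFun_lineThetaLift`, compact quotient `compactSpace_automorphicQuotient_cm`); (i) a continuous function
vanishing `μA`-a.e. for an open-positive `μA` vanishes (`Continuous.ae_eq_iff_eq`), but its value at `[x₀⁻¹]` is `Θ(x₀) ≠ 0` (`toQuotFun_mk` + left invariance
`lineThetaLiftFun_transport_mul_left`); (ii-hol) SP `holCotFormSpectralProjection_holds` projects the holomorphic pair onto `P′` as a holomorphic pair `Ψ` whose
`j₀`-class is `pr_{P′}[…] ≠ 0`, so `Ψ ≠ 0`, `P′.ContainsForm Ψ` (`Submodule.starProjection_apply_mem`); (ii-fin) B′ `hasFinComponent_rhoAtLine_three_of_starProjection_ne_zero_of_coe`.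
[cite: Liu2021, proof of Prop. 4.13 Case 1 (l. 2131–2141, p. 48) and «Conversely» (l. 2145–2149); App. D Lem. D.1, Lem. D.2 (2)]
[cite: BorelJacquet1979, §4.2, §4.6] [cite: Borel1997, Thm. 2.13 and §8.4] [cite: Rallis1984, Thm. 1.2.2 proof p. 356] -/
theorem capHolThetaWitness_of_holThetaPair :
    ∀ (L : Type) [Field L] [NumberField L] [IsCMField L] (ι : L →+* ℂ) (H : Matrix (Fin 3) (Fin 3) L) (T : GL (Fin 3) ℂ)
      (hT : (T : Matrix (Fin 3) (Fin 3) ℂ)ᴴ * H.map ι * (T : Matrix (Fin 3) (Fin 3) ℂ) = Literature.Geometry.ComplexHyperbolic.BallModel.J),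
      (∀ τ' : L →+* ℂ, InfinitePlace.mk τ' ≠ InfinitePlace.mk ι → (H.map τ').PosDef) → 2 ≤ Module.finrank ℚ ↥(maximalRealSubfield L) →
      ∀ {n' : ℕ} (e₁ : Fin 3 × Fin 1 ≃ Fin n') (dV : Fin 3 → L) (hdV : ∀ i, IsCMField.complexConj L (dV i) = dV i)
        (hdV0 : ∀ i, dV i ≠ 0) (g : GL (Fin 3) L)
        (hg : ((g : Matrix (Fin 3) (Fin 3) L).map (cmConjRingHom L))ᵀ * H * (g : Matrix (Fin 3) (Fin 3) L) = Matrix.diagonal dV)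
        (ιA : (adelicGroupData (↥(maximalRealSubfield L)) L (IsCMField.complexConj L) 3 H).Adelic →*
            ↥(UnitaryGroup.adelic (↥(maximalRealSubfield L)) L (IsCMField.complexConj L) 3 (Matrix.diagonal dV))),
          (∀ k, ((ιA k : ↥(UnitaryGroup.adelic (↥(maximalRealSubfield L)) L (IsCMField.complexConj L) 3 (Matrix.diagonal dV))) :
                GL (Fin 3) (AdeleRing (𝓞 L) L)) =
              (toAdeleGL L g)⁻¹ * adelicVal (↥(maximalRealSubfield L)) L (IsCMField.complexConj L) 3 H k * toAdeleGL L g) →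
        ∀ (ιV : finAdelic (↥(maximalRealSubfield L)) L (IsCMField.complexConj L) 3 H →*
            finAdelic (↥(maximalRealSubfield L)) L (IsCMField.complexConj L) 3 (Matrix.diagonal dV)),
          (∀ k, ((ιV k : finAdelic (↥(maximalRealSubfield L)) L (IsCMField.complexConj L) 3 (Matrix.diagonal dV)) :
              GL (Fin 3) (FiniteAdeleRing (𝓞 L) L)) =
            (toFinAdeleGL L 3 g)⁻¹ * (k : GL (Fin 3) (FiniteAdeleRing (𝓞 L) L)) * toFinAdeleGL L 3 g) →
        ∀ [CompactSpace (↥(UnitaryGroup.adelic (↥(maximalRealSubfield L)) L (IsCMField.complexConj L) 3 (Matrix.diagonal dV)) ⧸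
            (UnitaryGroup.toAdelic (↥(maximalRealSubfield L)) L (IsCMField.complexConj L) 3 (Matrix.diagonal dV)).range)],
        ∀ (μA : Measure (adelicGroupData (↥(maximalRealSubfield L)) L (IsCMField.complexConj L) 3 H).automorphicQuotient)
          [(adelicGroupData (↥(maximalRealSubfield L)) L (IsCMField.complexConj L) 3 H).IsAutomorphicMeasure μA]
          (μ : Literature.NumberTheory.Automorphic.IdeleClassGroup L →ₜ* Circle) (hμ : IsConjugateSymplectic L μ)
          (a : (↥(maximalRealSubfield L))ˣ) (χ : Chi (↥(maximalRealSubfield L)) L (IsCMField.complexConj L)),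
            letI : MeasurableSpace (↥(UnitaryGroup.adelic (↥(maximalRealSubfield L)) L (IsCMField.complexConj L) 1
                (JW (↥(maximalRealSubfield L)) L a)) ⧸
                  (UnitaryGroup.toAdelic (↥(maximalRealSubfield L)) L (IsCMField.complexConj L) 1 (JW (↥(maximalRealSubfield L)) L a)).range) :=
              borel _
            ∀ (hρ : HasThetaMajorants fun
                (p : ↥(UnitaryGroup.adelic (↥(maximalRealSubfield L)) L (IsCMField.complexConj L) 3 (Matrix.diagonal dV)) ×
                  ↥(UnitaryGroup.adelic (↥(maximalRealSubfield L)) L (IsCMField.complexConj L) 1 (JW (↥(maximalRealSubfield L)) L a)))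
                (Φ : piSchwartzBruhat (↥(maximalRealSubfield L)) (Fin n')) =>
                  pairRep (↥(maximalRealSubfield L)) L (IsCMField.complexConj L) 3 1 e₁ (Matrix.diagonal dV) (JW (↥(maximalRealSubfield L)) L a)
                    (chiSplittingLine L e₁ dV hdV hdV0 (toHeckeCharacter L μ) (isUnitary_toHeckeCharacter L μ)
                      ((isOscillatorChar_toHeckeCharacter_iff μ).mpr hμ) (TW (↥(maximalRealSubfield L)) a)
                      (isUnit_det_TW (↥(maximalRealSubfield L)) a) (JW (↥(maximalRealSubfield L)) L a) (JW_eq (↥(maximalRealSubfield L)) L a))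
                    p Φ)
              (μW : Measure (↥(UnitaryGroup.adelic (↥(maximalRealSubfield L)) L (IsCMField.complexConj L) 1
                (JW (↥(maximalRealSubfield L)) L a)) ⧸
                  (UnitaryGroup.toAdelic (↥(maximalRealSubfield L)) L (IsCMField.complexConj L) 1 (JW (↥(maximalRealSubfield L)) L a)).range))
              (_ : IsFiniteMeasure μW)
              (_ : SMulInvariantMeasure
                (↥(UnitaryGroup.adelic (↥(maximalRealSubfield L)) L (IsCMField.complexConj L) 1 (JW (↥(maximalRealSubfield L)) L a)))
                (↥(UnitaryGroup.adelic (↥(maximalRealSubfield L)) L (IsCMField.complexConj L) 1 (JW (↥(maximalRealSubfield L)) L a)) ⧸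
                  (UnitaryGroup.toAdelic (↥(maximalRealSubfield L)) L (IsCMField.complexConj L) 1 (JW (↥(maximalRealSubfield L)) L a)).range)
                μW)
              (φ : Fin 2 → 𝓢(((Fin 3 × Fin 1) → NumberField.mixedEmbedding.mixedSpace ↥(maximalRealSubfield L)), ℂ))
              (Φf : FinSB (↥(maximalRealSubfield L)) (Fin 3 × Fin 1)) (j₀ : Fin 2),
              (haveI := normal_range_toAdelic_JW L a
               (fun (x : (adelicGroupData (↥(maximalRealSubfield L)) L (IsCMField.complexConj L) 3 H).Adelic) (j : Fin 2) =>
                  (lineThetaKernelDatum L 3 e₁ dV hdV hdV0 μ hμ a hρ).thetaLiftFun μW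
                    (piSBReindex (↥(maximalRealSubfield L)) e₁
                      (piSchwartzBruhatEquiv (↥(maximalRealSubfield L)) (Fin 3 × Fin 1) (φ j ⊗ₜ[ℂ] Φf)))
                    (charCM (chiQuot (↥(maximalRealSubfield L)) L (IsCMField.complexConj L) (Algebra.IsQuadraticExtension.finrank_eq_two _ L)
                      (IsCMField.complexConj_ne_one (K := L)) a χ))
                    ((cmAdelicFrameTransport L 3 H dV g hg) x)) ∈
                holCotForms (↥(maximalRealSubfield L)) L (IsCMField.complexConj L) 3 H (cmArchSection L ι H T hT) (cmCompactFactor L ι H T hT)) →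
              (haveI := normal_range_toAdelic_JW L a
               ∃ x₀ : (adelicGroupData (↥(maximalRealSubfield L)) L (IsCMField.complexConj L) 3 H).Adelic,
                  (lineThetaKernelDatum L 3 e₁ dV hdV hdV0 μ hμ a hρ).thetaLiftFun μW
                    (piSBReindex (↥(maximalRealSubfield L)) e₁
                      (piSchwartzBruhatEquiv (↥(maximalRealSubfield L)) (Fin 3 × Fin 1) (φ j₀ ⊗ₜ[ℂ] Φf)))
                    (charCM (chiQuot (↥(maximalRealSubfield L)) L (IsCMField.complexConj L) (Algebra.IsQuadraticExtension.finrank_eq_two _ L)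
                      (IsCMField.complexConj_ne_one (K := L)) a χ))
                    ((cmAdelicFrameTransport L 3 H dV g hg) x₀) ≠ 0) →
            ∃ (hρ : HasThetaMajorants fun
                (p : ↥(UnitaryGroup.adelic (↥(maximalRealSubfield L)) L (IsCMField.complexConj L) 3 (Matrix.diagonal dV)) ×
                  ↥(UnitaryGroup.adelic (↥(maximalRealSubfield L)) L (IsCMField.complexConj L) 1 (JW (↥(maximalRealSubfield L)) L a)))
                (Φ : piSchwartzBruhat (↥(maximalRealSubfield L)) (Fin n')) =>
                  pairRep (↥(maximalRealSubfield L)) L (IsCMField.complexConj L) 3 1 e₁ (Matrix.diagonal dV) (JW (↥(maximalRealSubfield L)) L a)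
                    (chiSplittingLine L e₁ dV hdV hdV0 (toHeckeCharacter L μ) (isUnitary_toHeckeCharacter L μ)
                      ((isOscillatorChar_toHeckeCharacter_iff μ).mpr hμ) (TW (↥(maximalRealSubfield L)) a)
                      (isUnit_det_TW (↥(maximalRealSubfield L)) a) (JW (↥(maximalRealSubfield L)) L a) (JW_eq (↥(maximalRealSubfield L)) L a))
                    p Φ)
              (μW : Measure (↥(UnitaryGroup.adelic (↥(maximalRealSubfield L)) L (IsCMField.complexConj L) 1
                (JW (↥(maximalRealSubfield L)) L a)) ⧸
                  (UnitaryGroup.toAdelic (↥(maximalRealSubfield L)) L (IsCMField.complexConj L) 1 (JW (↥(maximalRealSubfield L)) L a)).range))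
              (_ : IsFiniteMeasure μW)
              (_ : SMulInvariantMeasure
                (↥(UnitaryGroup.adelic (↥(maximalRealSubfield L)) L (IsCMField.complexConj L) 1 (JW (↥(maximalRealSubfield L)) L a)))
                (↥(UnitaryGroup.adelic (↥(maximalRealSubfield L)) L (IsCMField.complexConj L) 1 (JW (↥(maximalRealSubfield L)) L a)) ⧸
                  (UnitaryGroup.toAdelic (↥(maximalRealSubfield L)) L (IsCMField.complexConj L) 1 (JW (↥(maximalRealSubfield L)) L a)).range)
                μW)
              (f : C(↥(UnitaryGroup.adelic (↥(maximalRealSubfield L)) L (IsCMField.complexConj L) 1 (JW (↥(maximalRealSubfield L)) L a)) ⧸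
                (UnitaryGroup.toAdelic (↥(maximalRealSubfield L)) L (IsCMField.complexConj L) 1 (JW (↥(maximalRealSubfield L)) L a)).range, ℂ))
              (Φ : piSchwartzBruhat (↥(maximalRealSubfield L)) (Fin n'))
              (hθ : MemLp (toQuotFun (adelicGroupData (↥(maximalRealSubfield L)) L (IsCMField.complexConj L) 3 H) fun x =>
                (lineThetaKernelDatum L 3 e₁ dV hdV hdV0 μ hμ a hρ).thetaLiftFun μW Φ f (ιA x)) 2 μA),
              MemLp.toLp _ hθ ≠ 0 ∧
              ∀ P' : DiscreteAutomorphicRep (adelicGroupData (↥(maximalRealSubfield L)) L (IsCMField.complexConj L) 3 H) μA,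
                P'.space.toSubmodule.starProjection (MemLp.toLp _ hθ) ≠ 0 →
                P'.IsHolCotangentAt (cmArchSection L ι H T hT) (cmCompactFactor L ι H T hT) ∧
                P'.HasFinComponent
                  (rhoAtLine (↥(maximalRealSubfield L)) L (IsCMField.complexConj L) 3 e₁ (Matrix.diagonal dV)
                    (complexConj_imagUnit L) (imagUnit_ne_zero L) (imagUnit_mul_self L) (realDiagonal_isSymm L dV hdV)
                    (isUnit_det_realDiagonal L dV hdV hdV0) (realDiagonal_map L dV hdV).symm
                    (fun a => isCompatible_chiSplittingLine L e₁ dV hdV hdV0 (toHeckeCharacter L μ)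
                      (isUnitary_toHeckeCharacter L μ) ((isOscillatorChar_toHeckeCharacter_iff μ).mpr hμ)
                      (TW (↥(maximalRealSubfield L)) a) (isSymm_TW (↥(maximalRealSubfield L)) a)
                      (isUnit_det_TW (↥(maximalRealSubfield L)) a) (JW (↥(maximalRealSubfield L)) L a)
                      (JW_eq (↥(maximalRealSubfield L)) L a)) ιV a χ) := by
  intro L _ _ _ ι H T hT hpos h2 n' e₁ dV hdV hdV0 g hg ιA hιA ιV hιV _ μA _ μ hμ a χ hρ μW hfinW hinvW φ Φf j₀ hhol hne
  -- the pinned adelic transport IS the canonical one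
  obtain rfl := eq_cmAdelicFrameTransport_of_coe L 3 H dV g hg ιA hιA
  letI : MeasurableSpace (↥(UnitaryGroup.adelic (↥(maximalRealSubfield L)) L (IsCMField.complexConj L) 1
      (JW (↥(maximalRealSubfield L)) L a)) ⧸
        (UnitaryGroup.toAdelic (↥(maximalRealSubfield L)) L (IsCMField.complexConj L) 1 (JW (↥(maximalRealSubfield L)) L a)).range) :=
    borel _
  haveI : BorelSpace (↥(UnitaryGroup.adelic (↥(maximalRealSubfield L)) L (IsCMField.complexConj L) 1
      (JW (↥(maximalRealSubfield L)) L a)) ⧸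
        (UnitaryGroup.toAdelic (↥(maximalRealSubfield L)) L (IsCMField.complexConj L) 1 (JW (↥(maximalRealSubfield L)) L a)).range) :=
    ⟨rfl⟩
  haveI := normal_range_toAdelic_JW L a
  haveI : IsFiniteMeasure μW := hfinW
  haveI := hinvW
  haveI : CompactSpace (adelicGroupData (↥(maximalRealSubfield L)) L (IsCMField.complexConj L) 3 H).automorphicQuotient :=
    compactSpace_automorphicQuotient_cm (L := L) (ι := ι) (H := H) hpos h2
  obtain ⟨x₀, hx₀⟩ := hne
  -- the `L²`-class of the `j₀`-th coordinate
  have hθ := memLp_toQuotFun_lineThetaLift L 3 H e₁ dV hdV hdV0 g hg μ hμ a hρ μW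
    (piSBReindex (↥(maximalRealSubfield L)) e₁ (piSchwartzBruhatEquiv (↥(maximalRealSubfield L)) (Fin 3 × Fin 1) (φ j₀ ⊗ₜ[ℂ] Φf)))
    (charCM (chiQuot (↥(maximalRealSubfield L)) L (IsCMField.complexConj L) (Algebra.IsQuadraticExtension.finrank_eq_two _ L)
      (IsCMField.complexConj_ne_one (K := L)) a χ)) μA 2
  refine ⟨hρ, μW, hfinW, hinvW, _, _, hθ, ?_, ?_⟩
  · -- (i) the class is non-zero: a continuous function on the compact quotient vanishing a.e. for the open-positive `μA` vanishes
    intro h0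
    have hae := (Lp.eq_zero_iff_ae_eq_zero.mp h0)
    have hae' := (MemLp.coeFn_toLp hθ).symm.trans hae
    have hcont := continuous_toQuotFun_lineThetaLift L 3 H e₁ dV hdV hdV0 g hg μ hμ a hρ μW
      (piSBReindex (↥(maximalRealSubfield L)) e₁ (piSchwartzBruhatEquiv (↥(maximalRealSubfield L)) (Fin 3 × Fin 1) (φ j₀ ⊗ₜ[ℂ] Φf)))
      (charCM (chiQuot (↥(maximalRealSubfield L)) L (IsCMField.complexConj L) (Algebra.IsQuadraticExtension.finrank_eq_two _ L)
        (IsCMField.complexConj_ne_one (K := L)) a χ))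
    have hzero := (hcont.ae_eq_iff_eq μA continuous_const).mp hae'
    have hval := congr_fun hzero
      ((adelicGroupData (↥(maximalRealSubfield L)) L (IsCMField.complexConj L) 3 H).toAutomorphicQuotient x₀⁻¹)
    rw [toQuotFun_mk (fun γ hγ y => lineThetaLiftFun_transport_mul_left L 3 H e₁ dV hdV hdV0 g hg μ hμ a hρ μW _ _ hγ y), inv_inv] at hval
    exact hx₀ hval
  · -- (ii) the receivers
    intro P' hP'
    refine ⟨?_, ?_⟩
    · -- (ii-hol) spectral projection of the holomorphic pair (★ SP)
      have hΦ : ∀ j : Fin 2, MemLp (toQuotFun (adelicGroupData (↥(maximalRealSubfield L)) L (IsCMField.complexConj L) 3 H) fun x =>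
          (fun (x : (adelicGroupData (↥(maximalRealSubfield L)) L (IsCMField.complexConj L) 3 H).Adelic) (j : Fin 2) =>
            (lineThetaKernelDatum L 3 e₁ dV hdV hdV0 μ hμ a hρ).thetaLiftFun μW
              (piSBReindex (↥(maximalRealSubfield L)) e₁
                (piSchwartzBruhatEquiv (↥(maximalRealSubfield L)) (Fin 3 × Fin 1) (φ j ⊗ₜ[ℂ] Φf)))
              (charCM (chiQuot (↥(maximalRealSubfield L)) L (IsCMField.complexConj L) (Algebra.IsQuadraticExtension.finrank_eq_two _ L)
                (IsCMField.complexConj_ne_one (K := L)) a χ))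
              ((cmAdelicFrameTransport L 3 H dV g hg) x)) x j) 2 μA :=
        fun j => memLp_toQuotFun_lineThetaLift L 3 H e₁ dV hdV hdV0 g hg μ hμ a hρ μW _ _ μA 2
      obtain ⟨Ψ, hΨmem, hΨ, heq⟩ := holCotFormSpectralProjection_holds L ι H T hT hpos h2 μA P' _ hhol hΦ
      refine ⟨Ψ, hΨmem, ?_, fun j => ⟨hΨ j, ?_⟩⟩
      · -- `Ψ ≠ 0`: its `j₀`-class is `pr_{P′}[Θ_{j₀}] ≠ 0`
        rintro rfl
        apply hP'
        rw [heq j₀]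
        exact Lp.eq_zero_iff_ae_eq_zero.mpr ((MemLp.coeFn_toLp _).trans (Filter.Eventually.of_forall fun _ => rfl))
      · -- the projected classes lie in `P′`
        rw [← heq j]
        exact Submodule.starProjection_apply_mem _ _
    · -- (ii-fin) node B′ at the pinned `ιV`
      exact F0P2sNodeBPrime.hasFinComponent_rhoAtLine_three_of_starProjection_ne_zero_of_coe L H e₁ dV hdV hdV0 g hg μ hμ a hρ μW
        (φ j₀) P' χ Φf ιV hιV hP'


end Summit.HodgeConjecture.HodgeConjecture.Cruxes.H413.K2E2CapHolThetaWitness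

end
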